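import Summits.AtomisticToContinuum.HydrodynamicLimit.Theses.LindebergRandomFuture
import Summits.AtomisticToContinuum.HydrodynamicLimit.Theorems.LambertianContactSwapLambertianEulerOfHearts
import Summits.AtomisticToContinuum.HydrodynamicLimit.Theses.LambertianContactSwap
import Summits.AtomisticToContinuum.HydrodynamicLimit.Theorems.LambertianContactSwapLambertianEulerArchimedes
import Summits.AtomisticToContinuum.HydrodynamicLimit.Theorems.LambertianContactSwapLambertianEulerLambertLaw
import Summits.AtomisticToContinuum.HydrodynamicLimit.Theorems.LambertianContactSwapLambertianEulerPovzner
import Summits.AtomisticToContinuum.HydrodynamicLimit.Theorems.LambertianContactSwapLambertianEulerPairPovzner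
import Summits.AtomisticToContinuum.HydrodynamicLimit.Theorems.LambertianContactSwapLambertianEulerContactIsotropy
import Summits.AtomisticToContinuum.HydrodynamicLimit.Theorems.LambertianContactSwapLambertianEulerMomentLedgerChain
import Summits.AtomisticToContinuum.HydrodynamicLimit.Theorems.LambertianContactSwapLambertianEulerGibbsInvariance
import Summits.AtomisticToContinuum.HydrodynamicLimit.Theorems.LambertianContactSwapLambertianEulerEntropyToHydro
import Summits.AtomisticToContinuum.HydrodynamicLimit.Theorems.LambertianContactSwapLambertianEulerWindow
import Summits.AtomisticToContinuum.HydrodynamicLimit.Theorems.LambertianContactSwapLambertianEulerMarkov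
import Summits.AtomisticToContinuum.HydrodynamicLimit.Theorems.LambertianContactSwapLambertianEulerIterate
import Summits.AtomisticToContinuum.HydrodynamicLimit.Theorems.LambertianContactSwapLambertianEulerDock
import Summits.AtomisticToContinuum.HydrodynamicLimit.Theorems.LambertianContactSwapLambertianEulerKlLedger
import Summits.AtomisticToContinuum.HydrodynamicLimit.Theorems.LambertianContactSwapLambertianEulerLawSemigroup
import Summits.AtomisticToContinuum.HydrodynamicLimit.Theorems.LambertianContactSwapLambertianEulerDockRf
import Summits.AtomisticToContinuum.HydrodynamicLimit.Theorems.LambertianContactSwapLambertianEulerLambertDirMean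
import Summits.AtomisticToContinuum.HydrodynamicLimit.Theorems.LambertianContactSwapLambertianEulerPairMeanSq
import Summits.AtomisticToContinuum.HydrodynamicLimit.Theorems.LambertianContactSwapLambertianEulerPathwiseProduction
import Summits.AtomisticToContinuum.HydrodynamicLimit.Theorems.LambertianContactSwapLambertianEulerWindowLedger
import Summits.AtomisticToContinuum.HydrodynamicLimit.Theorems.LambertianContactSwapLambertianEulerCollisionCompensator
import Summits.AtomisticToContinuum.HydrodynamicLimit.Theorems.LambertianContactSwapLambertianEulerCompensatedJump
import Summits.AtomisticToContinuum.HydrodynamicLimit.Theorems.LambertianContactSwapLambertianEulerAprioriEntropyBound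
import Summits.AtomisticToContinuum.HydrodynamicLimit.Theorems.LambertianContactSwapLambertianEulerCollisionIntensity
import Summits.AtomisticToContinuum.HydrodynamicLimit.Theorems.LambertianContactSwapLambertianEulerTwoTimeLaw
import Summits.AtomisticToContinuum.HydrodynamicLimit.Theorems.LambertianContactSwapLambertianEulerCollisionBudget
import Summits.AtomisticToContinuum.HydrodynamicLimit.Theorems.LambertianContactSwapLambertianEulerExpectedWindowProductionTools
import Summits.AtomisticToContinuum.HydrodynamicLimit.Theorems.LambertianContactSwapLambertianEulerExpectedWindowProduction
import Summits.AtomisticToContinuum.HydrodynamicLimit.Theorems.LambertianContactSwapLambertianEulerProductionSplit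
import Summits.AtomisticToContinuum.HydrodynamicLimit.Theorems.TwoClocksClampedEntropyClockTimeZeroReference
import Summits.AtomisticToContinuum.HydrodynamicLimit.Theorems.TwoClocksClampedEntropyClockDiscreteEntropyGronwall
import Summits.AtomisticToContinuum.HydrodynamicLimit.Theorems.TwoClocksClampedEntropyClockKlDivLawAtLocalGibbsNeTop
import Literature.MathematicalPhysics.KineticTheory.LambertianRedrawNondegenerate
import Literature.MathematicalPhysics.KineticTheory.Hilbert6Wave0Proofs
import Literature.MathematicalPhysics.KineticTheory.HardSphereEulerLLN
import Literature.Barriers.AtomisticToContinuum.HighMomentumCutoff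
import Literature.Analysis.FluidPDE.HardSphereAlexander
import HarnessLib

/-! TTRL-lite variant V12897 of stmt-AtomisticToContinuum-11854

Abstract shell over an arbitrary entropy functional `H` and current `Y`: to obtain the
one-block bound for every `ε > 0` it suffices to have it for `0 < ε < 1`, because the
error term `ε * (N + 1)` is monotone in `ε` (for `ε ≥ 1` reuse the threshold of `ε := 1/2`).
Pure logic. -/

namespace Summit.AtomisticToContinuum.HydrodynamicLimit.Theorems

open scoped BigOperators Topology ENNReal InnerProductSpace
open MeasureTheory ProbabilityTheory Filter Set InformationTheory
open Literature.MathematicalPhysics.KineticTheory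
open Literature.Analysis.FluidPDE Literature.Analysis.FluidPDE.Alexander
open Summit.AtomisticToContinuum.HydrodynamicLimit.Theses.LambertianContactSwap
open Summit.AtomisticToContinuum.HydrodynamicLimit.Theorems.ClampedCurrentsDockPathwise (gSum DgSum)

/-- TTRL-lite variant V12897 of `stub_kineticOneBlockInMeanLambda` (stmt-AtomisticToContinuum-11854):
if the one-block bound `-(Y N s s') ≤ C (s'-s) M + ε (N+1)` holds eventually in `N` for every
`ε ∈ (0,1)`, then it holds eventually in `N` for every `ε > 0` (for `ε ≥ 1` use the threshold
of `ε := 1/2` and monotonicity of `ε ↦ ε (N+1)`). -/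
theorem stub_kineticOneBlockInMeanLambda_var12897 :
    ∀ (t : ℝ) (H : ℕ → ℝ → ℝ) (Y : ℕ → ℝ → ℝ → ℝ), (∃ C : ℝ, 0 ≤ C ∧ ∀ ε : ℝ, 0 < ε → ε < 1 → ∃ N₀ : ℕ, ∀ N : ℕ, N₀ ≤ N → ∀ (s s' M : ℝ), 0 ≤ s → s ≤ s' → s' ≤ t → (∀ r' ∈ Set.Icc s s', H N r' ≤ M) → -(Y N s s') ≤ C * (s' - s) * M + ε * ((N : ℝ) + 1)) → ∃ C : ℝ, 0 ≤ C ∧ ∀ ε : ℝ, 0 < ε → ∃ N₀ : ℕ, ∀ N : ℕ, N₀ ≤ N → ∀ (s s' M : ℝ), 0 ≤ s → s ≤ s' → s' ≤ t → (∀ r' ∈ Set.Icc s s', H N r' ≤ M) → -(Y N s s') ≤ C * (s' - s) * M + ε * ((N : ℝ) + 1) := by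
  intro t H Y hyp
  obtain ⟨C, hC0, hC⟩ := hyp
  refine ⟨C, hC0, ?_⟩
  intro ε hε
  by_cases hε1 : ε < 1
  · exact hC ε hε hε1
  · obtain ⟨N₀, hN₀⟩ := hC (1 / 2) (by norm_num) (by norm_num)
    refine ⟨N₀, ?_⟩
    intro N hN s s' M hs hss' hs't hH
    have h1 := hN₀ N hN s s' M hs hss' hs't hH
    have hN1 : (0 : ℝ) ≤ (N : ℝ) + 1 := by positivity
    have hε1' : (1 / 2 : ℝ) ≤ ε := by linarith [not_lt.mp hε1]
    have h2 : (1 / 2 : ℝ) * ((N : ℝ) + 1) ≤ ε * ((N : ℝ) + 1) :=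
      mul_le_mul_of_nonneg_right hε1' hN1
    linarith

end Summit.AtomisticToContinuum.HydrodynamicLimit.Theorems
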